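import Summits.CriticalPhenomena.PercolationContinuityZ3.Theorems.PercNearOneGluingNoHeavyQuantDIBStarFloorSplitInductionLumpyPC
import Summits.CriticalPhenomena.PercolationContinuityZ3.Theorems.PercNearOneGluingNoHeavyQuantOneBigCert
import HarnessLib

/-!
# QUANT lane R8, Conjecture DIB\* — the residual class after CELL F1: `StepLemmaFSTwoBigs ↔ ∀ x < 1, DIBStar x`

builds on p205010 (kernel theorem, internal audit signed; external expert review pending)

Statement + support file (`--supports stmt-CriticalPhenomena-4575`), QUANT lane lead (gen 19); memo
`run/shared/lean/prim/quant/prim-quant-lead-g19/LEAD-NOTES-G19.md` N38.  ONE `Prop` definition (the `@[conjecture]` `StepLemmaFSTwoBigs`),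
theorems otherwise; no sorries, standard axioms.

`…FloorSplitInductionLumpyPC` (lead g18, p266400) left the residual class of T-DIB = the lumpy core with a non-completing pair.  Two kernel
families remove more of it: (i) the lead's CELL F1 theorem `RootDec.tail_ge_of_oneBig` (p274645: DIB\* whenever exactly one blob exceeds
`j/2`), and (ii) typer g20's pair-completion rule `RootDec.term_ge_of_pairCompleting` applied to the set `B` of blobs of size `> j/2`
(pairwise completing by `RootDec.pairSet_of_twice`): DIB\* whenever `Σ_{b ∈ B} φ_x(g_b) ≥ 2`.  So the step may further assume AT LEAST TWO
blobs of size `> j/2` and `Σ_B φ < 2`: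

* `Quant.IndepBlob.StepLemmaFSTwoBigs` (`@[conjecture]`) — `StepLemmaFSLumpyPC` + (∃ k₁ ≠ k₂ with `j < 2·a k₁`, `j < 2·a k₂`) +
  (`Σ_{k : j < 2·a k} φ_x(g k) < 2`).
* `Quant.IndepBlob.stepLemmaFSLumpyPC_of_twoBigs`, **`stepLemmaFSTwoBigs_iff_dibStar : StepLemmaFSTwoBigs ↔ ∀ x < 1, DIBStar x`.**

RESIDUAL CLASS OF T-DIB after this file (cells F2 / F≥3 of README V227–V230): `1/2 < x < 1`; sizes `≤ j`; heavy total `≤ 2j`; empty blobs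
sure; ≥ 3 non-empty lights (`x² < g < x`), light total `≥ j+1`; credit `> 2j`; the largest blob of size `> j/(2x)` and gate `< 1`; a
non-completing pair; AT LEAST TWO blobs of size `> j/2`, whose rates sum to `< 2`.  Numerically the B/S certificate closes it with margin
`≥ 0.28(1−x)` (prim-quant-lead-g19/FOR-PROVERS-F2.md).  [this work]; the gluing rows served [cite: KozmaNitzan2024, Conjecture 3 (p. 15)].
-/

namespace Summit.CriticalPhenomena.PercolationContinuityZ3.Theorems

namespace Quant

namespace IndepBlob

open Finset

/-- **CONJECTURE — the floor-split step lemma on the residual class with at least two bigs** (lead g19): `StepLemmaFSLumpyPC` restricted to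
systems with two distinct blobs of size `> j/2` whose discounted rates over all such blobs sum to `< 2`.  Equivalent to `∀ x < 1, DIBStar x`
(`stepLemmaFSTwoBigs_iff_dibStar`); the complement inside the LumpyPC class is kernel (`RootDec.tail_ge_of_oneBig`, `RootDec.term_ge_of_pairCompleting`).
builds on p205010 (kernel theorem, internal audit signed; external expert review pending). [this work] [status: open] -/
@[conjecture] def StepLemmaFSTwoBigs : Prop :=
  ∀ (κ : Type) [Fintype κ] [DecidableEq κ] (a : κ → ℕ) (g : κ → ℝ) (j : ℕ) (x : ℝ),
    1 / 2 < x → x < 1 →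
    (∀ k, 0 ≤ g k ∧ g k ≤ 1) →
    (∀ k, g k < x → a k ≤ j) →
    (∑ k ∈ Finset.univ.filter (fun k => x ≤ g k), a k ≤ 2 * j) →
    (∀ k, x ≤ g k → a k ≤ j) →
    (∃ k₁ k₂ k₃, k₁ ≠ k₂ ∧ k₁ ≠ k₃ ∧ k₂ ≠ k₃ ∧ g k₁ < x ∧ 0 < a k₁ ∧ g k₂ < x ∧ 0 < a k₂ ∧ g k₃ < x ∧ 0 < a k₃) →
    (j + 1 ≤ ∑ k ∈ Finset.univ.filter (fun k => g k < x), a k) →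
    (∀ k, g k < x → 0 < a k → x ^ 2 < g k) →
    (∀ k, (∀ i, a i ≤ a k) → g k < 1) →
    (∀ k, a k = 0 → g k = 1) →
    (∃ k, (j : ℝ) < 2 * x * a k) →
    (∃ k l, k ≠ l ∧ 0 < a k ∧ 0 < a l ∧ a k + a l ≤ j) →
    (∃ k₁ k₂, k₁ ≠ k₂ ∧ j < 2 * a k₁ ∧ j < 2 * a k₂) →
    (∑ k ∈ Finset.univ.filter (fun k => j < 2 * a k), (if x ≤ g k then g k else (g k - x ^ 2) / (1 - x))) < 2 →
    (2 * j : ℝ) < ∑ k, (a k : ℝ) * (if x ≤ g k then g k else (g k - x ^ 2) / (1 - x)) →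
    (∀ k, 0 < a k → RootDec.CappedRows (Function.update a k 0) g) →
    x ≤ ∑ W : Finset κ, (∏ k, if k ∈ W then g k else 1 - g k) * (if j + 1 ≤ ∑ k ∈ W, a k then (1 : ℝ) else 0)

/-- The narrowed step lemma follows from DIB\* below one. [this work] -/
theorem stepLemmaFSTwoBigs_of_dibStar (h : ∀ x : ℝ, x < 1 → DIBStar x) : StepLemmaFSTwoBigs :=
  fun κ _ _ a g j x _ hx1 hg hlight _ _ _ _ _ _ _ _ _ _ _ hcredit _ => h x hx1 κ a g j hg hlight hcredit

/-- **F1 and the AMO family are kernel**: `StepLemmaFSTwoBigs → StepLemmaFSLumpyPC`. [this work] -/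
theorem stepLemmaFSLumpyPC_of_twoBigs (H : StepLemmaFSTwoBigs) : StepLemmaFSLumpyPC := by
  intro κ _ _ a g j x hx hx1 hg hlight hcorner hnogiant hthree hbig hpos hcore hempty hgran hpc hcredit hIH
  have hx0 : 0 ≤ x := by linarith
  -- every gate is at least x² (lights by `hpos`, empty blobs by `hempty`, heavies since x² ≤ x)
  have hjunk : ∀ i, x ^ 2 ≤ g i := by
    intro i
    by_cases hxi : x ≤ g i
    · nlinarith
    · rcases Nat.eq_zero_or_pos (a i) with h0 | hp0
      · rw [hempty i h0]; nlinarith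
      · exact (hpos i (not_le.1 hxi) hp0).le
  -- the set of bigs is pairwise completing; if its rates sum to ≥ 2 the pair-completion rule closes the row
  set T : Finset κ := Finset.univ.filter (fun k => j < 2 * a k) with hT
  by_cases hamo : 2 ≤ ∑ k ∈ T, (if x ≤ g k then g k else (g k - x ^ 2) / (1 - x))
  · have hpair := RootDec.pairSet_of_twice 0 j a T (fun k hk => by have := (Finset.mem_filter.1 hk).2; omega)
    have h := RootDec.term_ge_of_pairCompleting 0 a g j hg T hpair x hx.le hx1 hamo
    have e : (∑ W : Finset κ, (∏ k, if k ∈ W then g k else 1 - g k) * (if j + 1 ≤ 0 + ∑ k ∈ W, a k then (1 : ℝ) else 0)) =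
        ∑ W : Finset κ, (∏ k, if k ∈ W then g k else 1 - g k) * (if j + 1 ≤ ∑ k ∈ W, a k then (1 : ℝ) else 0) :=
      Finset.sum_congr rfl fun W _ => by rw [zero_add]
    rw [e] at h
    exact h
  by_cases htwo : ∃ k₁ k₂, k₁ ≠ k₂ ∧ j < 2 * a k₁ ∧ j < 2 * a k₂
  · exact H κ a g j x hx hx1 hg hlight hcorner hnogiant hthree hbig hpos hcore hempty hgran hpc htwo (not_le.1 hamo) hcredit hIH
  · -- exactly one big: CELL F1
    obtain ⟨k, hk⟩ := hgran
    have hak : (0 : ℝ) ≤ a k := Nat.cast_nonneg _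
    have hbigk : j < 2 * a k := by
      have : (j : ℝ) < 2 * (a k : ℝ) := by nlinarith
      exact_mod_cast this
    have hkj : a k ≤ j := by
      by_cases hxk : x ≤ g k
      · exact hnogiant k hxk
      · exact hlight k (not_le.1 hxk)
    have hsmall : ∀ i, i ≠ k → 2 * a i ≤ j := by
      intro i hi
      by_contra h
      exact htwo ⟨k, i, hi.symm, hbigk, by omega⟩
    exact RootDec.tail_ge_of_oneBig a g j x hx.le hx1 hg hjunk k hbigk hkj hsmall hcredit

/-- **`StepLemmaFSTwoBigs ⟹ DIB\*` at every floor `x < 1`.** [this work] -/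
theorem dibStar_of_stepLemmaFSTwoBigs (H : StepLemmaFSTwoBigs) (x : ℝ) (hx1 : x < 1) : DIBStar x :=
  dibStar_of_stepLemmaFSLumpyPC (stepLemmaFSLumpyPC_of_twoBigs H) x hx1

/-- **T-DIB ≡ the step lemma on the residual class with at least two bigs**: `StepLemmaFSTwoBigs ↔ ∀ x < 1, DIBStar x`. [this work] -/
theorem stepLemmaFSTwoBigs_iff_dibStar : StepLemmaFSTwoBigs ↔ ∀ x : ℝ, x < 1 → DIBStar x :=
  ⟨fun H x hx => dibStar_of_stepLemmaFSTwoBigs H x hx, stepLemmaFSTwoBigs_of_dibStar⟩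

end IndepBlob

end Quant

end Summit.CriticalPhenomena.PercolationContinuityZ3.Theorems
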